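import Summits.AtomisticToContinuum.BoseEinsteinCondensation.Theorems.BECPhaseQuadratureSumRuleCurrentSumRuleComplex

/-!
# Route `BECPhaseQuadratureSumRule`, support `CurrentSumRule` (stmt-AtomisticToContinuum-12618), IV:
# assembly lemmas — the complex amplitudes, the shifted Laplacian of `ρ_k†Ψ`, the final algebra

Supports stmt-AtomisticToContinuum-12618. With `Ψ = u₁ + iu₂` (`u₁ = Re Ψ`, `u₂ = Im Ψ`), a mode `m`
(`k = 2πm/L`, `κ = ‖k‖²`, `eⱼ = e^{ik·xⱼ}`, `∂ⱼ = k·∇_{xⱼ}`):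

* `rhoAmp_re_add_im`, `commAmp_re_add_im` — `ρ_k†Ψ = ρ_k u₁ + iρ_k u₂` and
  `A_kΨ := ∑ⱼeⱼ(-2i∂ⱼΨ + κΨ) = A_ku₁ + iA_ku₂` pointwise;
* `shiftedLaplacian_rhoAmp` — `(-Δ + V - E)(ρ_k†Ψ) = A_kΨ` for a `C²` solution of `-ΔΨ + VΨ = EΨ`
  (the commutator `[H, ρ_k†]`, from `puff_first_commutator` for `u₁`, `u₂`);
* `phaseHessianWeight` lemmas — continuity/non-negativity of
  `Φ(X) = ∑_{a<b}(1 - cos k·x_{ab})|∂_k∂_kw^per(x_{ab})|` and the `ℝ≥0∞ ↔ ℝ` conversion of `∫ Φ|Ψ|²`;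
* `sumRule_algebra` — the closing arithmetic `m₂² ≤ 4·(Nκ)·(12κT + Nκ³ + 4P)`.

References: S. Stringari, in *Bose–Einstein Condensation* (CUP 1995) §2.3 (19)–(23); R. D. Puff,
Phys. Rev. 137 (1965) A406.
-/

noncomputable section

namespace Summit.AtomisticToContinuum.BoseEinsteinCondensation.Theorems

open MeasureTheory
open scoped ENNReal NNReal BigOperators ComplexConjugate
open Literature.MathematicalPhysics.QuantumManyBody.BoseGas

namespace CurrentSumRule

variable {N : ℕ} {L : ℝ}

/-! ### The complex amplitudes through real and imaginary parts -/

/-- `ρ_k†Ψ = ρ_k u₁ + i ρ_k u₂` pointwise. [folklore] -/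
theorem rhoAmp_re_add_im (L : ℝ) (m : Fin 3 → ℤ) (ψ : Config N → ℂ) (X : Config N) :
    (∑ j : Fin N, cellWave L m (X j)) * ψ X =
      (∑ j : Fin N, cellWave L m (X j)) * (((ψ X).re : ℝ) : ℂ) +
        Complex.I * ((∑ j : Fin N, cellWave L m (X j)) * (((ψ X).im : ℝ) : ℂ)) := by
  linear_combination (∑ j : Fin N, cellWave L m (X j)) * eq_re_add_I_mul_im (ψ X)

/-- `A_kΨ = A_k u₁ + i A_k u₂` pointwise, with `A_kΨ = ∑ⱼ eⱼ(-2i∂ⱼΨ + κΨ)` and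
`A_k u = ∑ⱼ eⱼ(κu - 2i∂ⱼu)`. [folklore] -/
theorem commAmp_re_add_im {ψ : Config N → ℂ} {X : Config N} (hψ : DifferentiableAt ℝ ψ X) (L : ℝ)
    (m : Fin 3 → ℤ) (κ : ℝ) (k : Space) :
    ∑ j : Fin N, cellWave L m (X j) * ((-2 * Complex.I) * fderiv ℝ ψ X (Pi.single j k) + ((κ : ℝ) : ℂ) * ψ X) =
      (∑ j : Fin N, cellWave L m (X j) * (((κ : ℝ) : ℂ) * (((ψ X).re : ℝ) : ℂ) -
        2 * Complex.I * ((fderiv ℝ (fun Y => (ψ Y).re) X (Pi.single j k) : ℝ) : ℂ))) +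
      Complex.I * ∑ j : Fin N, cellWave L m (X j) * (((κ : ℝ) : ℂ) * (((ψ X).im : ℝ) : ℂ) -
        2 * Complex.I * ((fderiv ℝ (fun Y => (ψ Y).im) X (Pi.single j k) : ℝ) : ℂ)) := by
  rw [Finset.mul_sum, ← Finset.sum_add_distrib]
  refine Finset.sum_congr rfl fun j _ => ?_
  rw [fderiv_eq_re_add_im hψ]
  linear_combination (cellWave L m (X j) * ((κ : ℝ) : ℂ)) * eq_re_add_I_mul_im (ψ X)

/-- **The shifted Laplacian of the density wave: `(-Δ + V - E)(ρ_k†Ψ) = A_kΨ`** for a complex `C²`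
solution `Ψ` of `-ΔΨ + VΨ = EΨ` (`V` continuous real, `W = V - E`):
`-Δ((∑ⱼeⱼ)Ψ) + W(∑ⱼeⱼ)Ψ = ∑ⱼ eⱼ(-2i∂ⱼΨ + κΨ)` pointwise (the commutator `[H, ρ_k†]`, obtained
from the real and imaginary parts). [cite: Stringari1995, §2.3 (19)–(20)] -/
theorem shiftedLaplacian_rhoAmp {ψ : Config N → ℂ} (hψ : ContDiff ℝ 2 ψ) {V : Config N → ℝ} {E : ℝ}
    (m : Fin 3 → ℤ) {k : Space} (hk : k = (2 * Real.pi / L) • latticeVec 1 m)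
    (hEL : ∀ X : Config N, -(∑ i : Fin N, ∑ a : Fin 3,
        fderiv ℝ (fun Y : Config N => fderiv ℝ ψ Y (Pi.single i (EuclideanSpace.single a (1 : ℝ)))) X
          (Pi.single i (EuclideanSpace.single a (1 : ℝ)))) + ((V X : ℝ) : ℂ) * ψ X = ((E : ℝ) : ℂ) * ψ X)
    {W : Config N → ℝ} (hWVE : ∀ X, W X = V X - E) (X : Config N) :
    -(∑ i : Fin N, ∑ a : Fin 3, fderiv ℝ (fun Y : Config N => fderiv ℝ
        (fun Z : Config N => (∑ j : Fin N, cellWave L m (Z j)) * ψ Z) Y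
          (Pi.single i (EuclideanSpace.single a (1 : ℝ)))) X (Pi.single i (EuclideanSpace.single a (1 : ℝ)))) +
      ((W X : ℝ) : ℂ) * ((∑ j : Fin N, cellWave L m (X j)) * ψ X) =
    ∑ j : Fin N, cellWave L m (X j) *
      ((-2 * Complex.I) * fderiv ℝ ψ X (Pi.single j k) + (((‖k‖ ^ 2 : ℝ)) : ℂ) * ψ X) := by
  have hEq₁ := realEquation_re hψ hEL
  have hEq₂ := realEquation_im hψ hEL
  have hu₁ : ContDiff ℝ 2 fun Y => (ψ Y).re := Complex.reCLM.contDiff.comp hψ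
  have hu₂ : ContDiff ℝ 2 fun Y => (ψ Y).im := Complex.imCLM.contDiff.comp hψ
  have h1 := puff_first_commutator m hk hu₁ hEq₁ X
  have h2 := puff_first_commutator m hk hu₂ hEq₂ X
  have hG : (fun Z : Config N => (∑ j : Fin N, cellWave L m (Z j)) * ψ Z) = fun Z =>
      (∑ j : Fin N, cellWave L m (Z j)) * (((ψ Z).re : ℝ) : ℂ) +
        Complex.I * ((∑ j : Fin N, cellWave L m (Z j)) * (((ψ Z).im : ℝ) : ℂ)) :=
    funext fun Z => rhoAmp_re_add_im L m ψ Z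
  rw [hG, rhoAmp_re_add_im L m ψ X, commAmp_re_add_im (hψ.differentiable two_ne_zero X) L m _ k,
    ← h1, ← h2, hWVE X]
  simp_rw [fderiv_fderiv_add_const_mul_apply (contDiff_rhoAmp L m hu₁) (contDiff_rhoAmp L m hu₂)]
  simp only [Finset.sum_add_distrib, ← Finset.mul_sum]
  push_cast
  ring

/-! ### The phase-weighted Hessian `Φ(X) = ∑_{a<b}(1 - cos k·x_{ab})|∂_k∂_k w^per(x_{ab})|` -/

section Weight

variable {w : ℝ → ℝ≥0∞} {R₀ : ℝ} (k : Space)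

/-- The phase-weighted Hessian is non-negative. [folklore] -/
theorem phaseHessianWeight_nonneg (g : Space → ℝ) (X : Config N) :
    0 ≤ ∑ a : Fin N, ∑ b : Fin N with a < b, (1 - Real.cos (inner ℝ k (X a - X b))) * |g (X a - X b)| :=
  Finset.sum_nonneg fun _ _ => Finset.sum_nonneg fun _ _ =>
    mul_nonneg (sub_nonneg.2 (Real.cos_le_one _)) (abs_nonneg _)

/-- The phase-weighted Hessian of `w^per` is continuous (`w` finite, range `R₀`, `2R₀ < L`,
`w̃ ∈ C²`). [folklore] -/
theorem continuous_phaseHessianWeight (hw : ∀ r, R₀ < r → w r = 0) (h2R : 2 * R₀ < L) (hL : 0 < L)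
    (hC : ContDiff ℝ 2 (fun x : Space => (w ‖x‖).toReal)) :
    Continuous fun X : Config N => ∑ a : Fin N, ∑ b : Fin N with a < b,
      (1 - Real.cos (inner ℝ k (X a - X b))) *
        |fderiv ℝ (fun x => fderiv ℝ (fun z => (periodizedPotential w L z).toReal) x k) (X a - X b) k| := by
  have hp : ContDiff ℝ 2 (fun y => (periodizedPotential w L y).toReal) :=
    contDiff_toReal_periodizedPotential hw h2R hL hC
  have hD1 : ContDiff ℝ 1 (fun x => fderiv ℝ (fun y => (periodizedPotential w L y).toReal) x k) :=
    (hp.fderiv_right (m := 1) (by norm_num)).clm_apply contDiff_const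
  have hHfc : Continuous fun y => fderiv ℝ (fun x => fderiv ℝ (fun z => (periodizedPotential w L z).toReal) x k) y k :=
    (hD1.continuous_fderiv one_ne_zero).clm_apply continuous_const
  have hab : ∀ a b : Fin N, Continuous fun X : Config N => X a - X b := fun a b =>
    (continuous_apply a).sub (continuous_apply b)
  refine continuous_finsetSum _ fun a _ => continuous_finsetSum _ fun b _ => ?_
  exact (continuous_const.sub (Real.continuous_cos.comp (continuous_const.inner (hab a b)))).mul
    ((continuous_abs.comp hHfc).comp (hab a b))

/-- **`∫⁻ (∑_{a<b} ofReal((1 - cos)|∂²w^per|)) |Ψ|² = ofReal ∫ Φ |Ψ|²`** for continuous `Ψ`. [folklore] -/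
theorem lintegral_phaseHessianWeight_eq (hw : ∀ r, R₀ < r → w r = 0) (h2R : 2 * R₀ < L) (hL : 0 < L)
    (hC : ContDiff ℝ 2 (fun x : Space => (w ‖x‖).toReal)) {ψ : Config N → ℂ} (hψ : Continuous ψ) :
    ∫⁻ X in cellN N L, (∑ a : Fin N, ∑ b : Fin N with a < b,
        ENNReal.ofReal ((1 - Real.cos (inner ℝ k (X a - X b))) *
          |fderiv ℝ (fun x => fderiv ℝ (fun z => (periodizedPotential w L z).toReal) x k) (X a - X b) k|)) *
        ((‖ψ X‖₊ : ℝ≥0∞)) ^ 2 =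
      ENNReal.ofReal (∫ X in cellN N L, (∑ a : Fin N, ∑ b : Fin N with a < b,
        (1 - Real.cos (inner ℝ k (X a - X b))) *
          |fderiv ℝ (fun x => fderiv ℝ (fun z => (periodizedPotential w L z).toReal) x k) (X a - X b) k|) *
        ‖ψ X‖ ^ 2) := by
  have h0 := phaseHessianWeight_nonneg (N := N) k
    (fun y => fderiv ℝ (fun x => fderiv ℝ (fun z => (periodizedPotential w L z).toReal) x k) y k)
  have hpt : ∀ X : Config N, (∑ a : Fin N, ∑ b : Fin N with a < b,
      ENNReal.ofReal ((1 - Real.cos (inner ℝ k (X a - X b))) *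
        |fderiv ℝ (fun x => fderiv ℝ (fun z => (periodizedPotential w L z).toReal) x k) (X a - X b) k|)) *
        ((‖ψ X‖₊ : ℝ≥0∞)) ^ 2 =
      ENNReal.ofReal ((∑ a : Fin N, ∑ b : Fin N with a < b,
        (1 - Real.cos (inner ℝ k (X a - X b))) *
          |fderiv ℝ (fun x => fderiv ℝ (fun z => (periodizedPotential w L z).toReal) x k) (X a - X b) k|) *
          ‖ψ X‖ ^ 2) := by
    intro X
    rw [ENNReal.ofReal_mul (h0 X), coe_nnnorm_sq_eq_ofReal, ENNReal.ofReal_sum_of_nonneg]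
    · congr 1
      refine Finset.sum_congr rfl fun a _ => ?_
      exact (ENNReal.ofReal_sum_of_nonneg fun b _ => mul_nonneg (sub_nonneg.2 (Real.cos_le_one _)) (abs_nonneg _)).symm
    · exact fun a _ => Finset.sum_nonneg fun b _ => mul_nonneg (sub_nonneg.2 (Real.cos_le_one _)) (abs_nonneg _)
  simp_rw [hpt]
  rw [← ofReal_integral_eq_lintegral_ofReal]
  · exact integrableOn_cellN ((continuous_phaseHessianWeight k hw h2R hL hC).mul (hψ.norm.pow 2)) L
  · exact ae_of_all _ fun X => mul_nonneg (h0 X) (sq_nonneg _)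

end Weight

/-! ### The closing arithmetic -/

/-- **The arithmetic of `m₂² ≤ 4 m₁ M₃`.** From the f-sum values `qG_r = Nκ I_r`, Puff's values
`qA_r = κ³N I_r + 12κ D_r + 2R_r` with `R_r ≤ 2F_r` (`r = 1, 2`: real and imaginary part), the
book-keeping `I₁ + I₂ = S` (`= ‖Ψ‖²`), `D₁ + D₂ = T`, `F₁ + F₂ = P`, the parallelogram bounds and
Cauchy–Schwarz `m₂² ≤ qG·qA`: `m₂² ≤ 4 (NκS)(12κT + Nκ₆S + 4P)` (`κ₆ = κ³`). [folklore] -/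
theorem sumRule_algebra {Nr κ κ₆ S I₁ I₂ D₁ D₂ R₁ R₂ F₁ F₂ T P m₂ qG qA qG₁ qG₂ qA₁ qA₂ : ℝ}
    (hκ : 0 ≤ κ) (hN : 0 ≤ Nr) (hS : 0 ≤ S) (hqA0 : 0 ≤ qA)
    (hG₁ : qG₁ = Nr * κ * I₁) (hG₂ : qG₂ = Nr * κ * I₂)
    (hA₁ : qA₁ = κ₆ * Nr * I₁ + 12 * κ * D₁ + 2 * R₁) (hA₂ : qA₂ = κ₆ * Nr * I₂ + 12 * κ * D₂ + 2 * R₂)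
    (hR₁ : R₁ ≤ 2 * F₁) (hR₂ : R₂ ≤ 2 * F₂) (hI : I₁ + I₂ = S) (hD : D₁ + D₂ = T) (hF : F₁ + F₂ = P)
    (hqG : qG ≤ 2 * qG₁ + 2 * qG₂) (hqA : qA ≤ 2 * qA₁ + 2 * qA₂) (hCS : m₂ ^ 2 ≤ qG * qA) :
    m₂ ^ 2 ≤ 4 * ((Nr * κ * S) * (12 * κ * T + Nr * κ₆ * S + 4 * P)) := by
  have hG : qG ≤ 2 * (Nr * κ * S) := by
    have h : 2 * qG₁ + 2 * qG₂ = 2 * (Nr * κ * S) := by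
      rw [hG₁, hG₂]; linear_combination 2 * Nr * κ * hI
    linarith
  have hA : qA ≤ 2 * (12 * κ * T + Nr * κ₆ * S + 4 * P) := by
    have h : 2 * qA₁ + 2 * qA₂ = 2 * (κ₆ * Nr * S) + 24 * κ * T + 4 * (R₁ + R₂) := by
      rw [hA₁, hA₂]; linear_combination 2 * κ₆ * Nr * hI + 24 * κ * hD
    linarith
  calc m₂ ^ 2 ≤ qG * qA := hCS
    _ ≤ (2 * (Nr * κ * S)) * (2 * (12 * κ * T + Nr * κ₆ * S + 4 * P)) :=
        mul_le_mul hG hA hqA0 (by positivity)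
    _ = 4 * ((Nr * κ * S) * (12 * κ * T + Nr * κ₆ * S + 4 * P)) := by ring

end CurrentSumRule

end Summit.AtomisticToContinuum.BoseEinsteinCondensation.Theorems

end
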